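import Summits.QuantumFields.QCD.Theorems.QuarksNoInfraredClauseTorusHalfSpectrumStubGammaFiveConjExpect
import Literature.MathematicalPhysics.QuantumLattice.GrassmannIntegralWilsonProofs
import HarnessLib

/-!
# Crux `TorusHalfSpectrum` (stmt-QuantumFields-9508), line `registered` (`Lines/birth.lean`, reshape v6) —
# stub `stub_gammaFiveConj_expectAP` (K1'): `γ₅`-conjugation symmetry of the time-ANTIPERIODIC torus functional

Stub K1' of the birth skeleton of the crux
`Summit.QuantumFields.QCD.Theses.QuarksNoInfraredClause.TorusHalfSpectrum`, the antiperiodic twin of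
stub K1 (`stub_gammaFiveConj_expect`, sibling file `…StubGammaFiveConjExpect.lean`): every
`γ₅`-conjugation `K` of the torus quark Grassmann algebra `FermiAlg Nf S` (a multiplicative, additive,
antilinear, unital map with `K ψ_{f,x,a,α} = −∑_σ (γ₅)_{σα} ψ̄_{f,x,a,σ}`,
`K ψ̄_{f,x,a,α} = ∑_σ (γ₅)_{ασ} ψ_{f,x,a,σ}` — the six CLAUSES of the skeleton's `IsGammaFiveConj K`)

1. FIXES the time-ANTIPERIODIC Wilson quark Boltzmann factor, `K e^{−ψ̄D^{AP}(U)ψ} = e^{−ψ̄D^{AP}(U)ψ}`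
   for every `SU(3)` gauge field `U` and all bare masses, and
2. CONJUGATES the antiperiodic torus functional (the honest thermal trace, the reflection-positive
   family), `⟨K ∘ X⟩^{AP}_{β,S,m} = conj ⟨X⟩^{AP}_{β,S,m}` for every Grassmann-valued `X`.

How.  Exactly as K1, with one new input: **`γ₅`-hermiticity of the antiperiodic Wilson–Dirac
operator** `QCDTimeReflection.wilsonDiracAP ρ U m r` — the tree's periodic `wilsonDirac` with the
forward hop at `(p,q)` multiplied by the REAL boundary sign `b_μ(p) = apLinkSign L p.1 μ` and the
backward hop at `(p,q)` by `b_μ(q)`; under `(p,q) ↔ (q,p)` plus complex conjugation the forward hop of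
`D_{pq}` faces the backward hop of `D_{qp}`, both carrying the same real sign `b_μ(p)`, so the entrywise
proof of `wilsonDirac_gammaFive_hermitian_holds` (Montvay–Münster (5.15): `ε_p D_{pq} ε_q = conj D_{qp}`,
`ε = (1,1,−1,−1)` the diagonal of `γ₅` in the chiral basis) goes through verbatim
(`wilsonDiracAP_signConj_apply`, any unitary colour representation, any real `m`, `r`, any `L`).
Flavour by flavour this gives `conj D^{AP}_{qp} = ε_p D^{AP}_{pq} ε_q` for the `N_f`-flavour matrix
`diracMatrixAP` (`star_diracMatrixAP_apply`), hence `(D^{AP})^K = D^{AP}` for the `K`-conjugate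
`kMatrix` of `QCDGammaFiveConjugation.lean` (`kMatrix_eq_self_of_signConj`, `kMatrix_diracMatrixAP`:
`γ₅ = diag ε` collapses the two spin sums), `torusK e^{−ψ̄D^{AP}ψ} = e^{−ψ̄D^{AP}ψ}`
(`torusK_fermiBoltzmannAP`, via K1's `torusK_grassmannExp`/`torusK_quadratic`), and
`⟨torusK ∘ X⟩^{AP} = conj ⟨X⟩^{AP}` (`qcdTorusExpectAP_torusK`: `∫dψ̄dψ ∘ K = det K₀ · conj ∘ ∫dψ̄dψ`,
`∫ conj = conj ∫`, the Jacobian cancels in the ratio — K1's `integral_fermiIntegral_torusK` and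
`div_eq_conj_div_of_eq_mul_conj`).  An arbitrary `γ₅`-conjugation `K` IS `torusK`
(`eq_torusK_of_clauses`, stub K0's file).

Everything used is proved in the tree (no named fact).  Sources: I. Montvay, G. Münster, *Quantum Fields
on a Lattice* (CUP 1994) §5.1.2 (5.15)–(5.16) (`γ₅`-hermiticity `Q_{yx} = γ₅ Q†_{xy} γ₅` and reality of
the quark determinant; numbered (4.35) in another edition), §4.2.4 (4.112)–(4.115) (the antiperiodic
boundary signs `b_x^± = −1` are real), §4.1.3 (4.34) (antiperiodic Grassmann time = the honest trace);
the packaging as an antilinear Grassmann ring map is folklore.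
-/

noncomputable section

namespace Summit.QuantumFields.QCD.Cruxes.TorusHalfSpectrum.Birth.GammaFiveConjExpectAP

open scoped BigOperators ComplexConjugate
open MeasureTheory
open Literature.Probability.LatticeModels Literature.MathematicalPhysics.QuantumFieldTheory
  Literature.MathematicalPhysics.QuantumLattice
open Summit.QuantumFields.QCD.Cruxes.TorusHalfSpectrum.Birth.GammaFiveConjExists
open Summit.QuantumFields.QCD.Cruxes.TorusHalfSpectrum.Birth.GammaFiveConjExpect

/-! ### `γ₅`-hermiticity of the antiperiodic Wilson–Dirac operator, entrywise -/

/-- **`γ₅`-hermiticity of the time-ANTIPERIODIC Wilson–Dirac operator, entrywise**: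
`ε_{σ_p} D^{AP}_{pq} ε_{σ_q} = conj D^{AP}_{qp}` with `ε = (1, 1, −1, −1)` (the diagonal of `γ₅` in the
chiral basis), for every colour representation `ρ` by unitary matrices, every gauge field, all real
`m`, `r` and every torus side `L`.  The proof of the periodic `wilsonDirac_gammaFive_hermitian_holds`
verbatim: the mass term is real diagonal; the forward hop of `D^{AP}_{pq}` and the backward hop of
`D^{AP}_{qp}` live on the same link `(p.1, μ)`, carry the SAME real boundary sign `b_μ(p.1)`
(`star_apLinkSign`), and `ε (r − γ_μ) ε = (r + γ_μ)†` entrywise, `conj ρ(g⁻¹)_{ba} = ρ(g)_{ab}`;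
symmetrically for the other pair. [cite: MontvayMunster1994, §5.1.2 (5.15)] -/
theorem wilsonDiracAP_signConj_apply {L N : ℕ} {G : Type*} [Group G]
    (ρ : G →* Matrix (Fin N) (Fin N) ℂ) (hρ : ∀ g, ρ g ∈ Matrix.unitaryGroup (Fin N) ℂ)
    (U : GaugeConfig 4 L G) (m r : ℝ) (p q : TorusSite 4 L × Fin N × Fin 4) :
    (![1, 1, -1, -1] : Fin 4 → ℂ) p.2.2 *
          _root_.Literature.MathematicalPhysics.QuantumFieldTheory.wilsonDiracAP ρ U m r p q *
        (![1, 1, -1, -1] : Fin 4 → ℂ) q.2.2 =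
      star (_root_.Literature.MathematicalPhysics.QuantumFieldTheory.wilsonDiracAP ρ U m r q p) := by
  simp only [_root_.Literature.MathematicalPhysics.QuantumFieldTheory.wilsonDiracAP, Matrix.of_apply]
  refine sign_conj_entry_aux _ _ _ _ _ _ _ _ _ ?_ (by simp) (fun μ => ?_) (fun μ => ?_)
  · -- mass term: real and diagonal
    by_cases h : p = q
    · subst h
      rw [if_pos rfl, mul_right_comm, gammaFiveSign_mul_self, one_mul]
      exact (Complex.conj_ofReal _).symm
    · rw [if_neg h, if_neg (Ne.symm h), mul_zero, zero_mul, star_zero]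
  · -- forward hop of `D_{pq}` versus backward hop of `D_{qp}`: same link `(p.1, μ)`, same sign
    split_ifs with h
    · rw [star_mul', star_mul', star_apLinkSign,
        ← gammaFiveSign_mul_sub_euclideanGamma_mul_gammaFiveSign r μ p.2.2 q.2.2,
        unitaryRep_star_inv_apply ρ hρ]
      ring
    · rw [mul_zero, zero_mul, star_zero]
  · -- backward hop of `D_{pq}` versus forward hop of `D_{qp}`: same link `(q.1, μ)`, same sign
    split_ifs with h
    · rw [star_mul', star_mul', star_apLinkSign,
        ← gammaFiveSign_mul_add_euclideanGamma_mul_gammaFiveSign r μ p.2.2 q.2.2,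
        unitaryRep_star_apply ρ hρ]
      ring
    · rw [mul_zero, zero_mul, star_zero]

variable {Nf L : ℕ} [NeZero L]

/-- **`γ₅`-hermiticity of the `N_f`-flavour antiperiodic Wilson matrix, entrywise**:
`conj D^{AP}_{qp} = ε_{σ_p} D^{AP}_{pq} ε_{σ_q}` with `ε = (1, 1, −1, −1)` at the spin of the quark
index (flavour by flavour `wilsonDiracAP_signConj_apply` for the unitary fundamental representation of
`SU(3)`; the off-diagonal flavour blocks vanish on both sides). [cite: MontvayMunster1994, §5.1.2 (5.15)] -/
theorem star_diracMatrixAP_apply (U : GaugeConfig 4 L (Matrix.specialUnitaryGroup (Fin 3) ℂ))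
    (mq : Fin Nf → ℝ) (p q : FermiIdx Nf L) :
    star (diracMatrixAP U mq q p) =
      (![1, 1, -1, -1] : Fin 4 → ℂ) (quarkEquiv.symm p).2.2.2 * diracMatrixAP U mq p q *
        (![1, 1, -1, -1] : Fin 4 → ℂ) (quarkEquiv.symm q).2.2.2 := by
  obtain ⟨⟨f, x⟩, rfl⟩ := quarkEquiv.surjective p
  obtain ⟨⟨g, y⟩, rfl⟩ := quarkEquiv.surjective q
  simp only [diracMatrixAP_apply, Equiv.symm_apply_apply]
  by_cases hfg : f = g
  · subst hfg
    rw [if_pos rfl, if_pos rfl]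
    exact (wilsonDiracAP_signConj_apply (fundamentalRep (Fin 3)) fundamentalRep_mem_unitaryGroup U
      (mq f) 1 x y).symm
  · rw [if_neg hfg, if_neg (Ne.symm hfg), mul_zero, zero_mul, star_zero]

/-! ### `(D^{AP}(U))^K = D^{AP}(U)` -/

/-- **A sign-conjugate matrix is its own `K`-conjugate**: if `conj A_{qp} = ε_{σ_p} A_{pq} ε_{σ_q}`
entrywise (`ε = (1, 1, −1, −1)` at the spin of the index), then `kMatrix A = A` — with
`γ₅ = diag ε` (`gammaFive_eq_diagonal`) the two spin sums of `kMatrix` collapse to the single term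
`ε_p (ε_p A_{pq} ε_q) ε_q = A_{pq}`. [folklore] -/
theorem kMatrix_eq_self_of_signConj (A : Matrix (FermiIdx Nf L) (FermiIdx Nf L) ℂ)
    (hA : ∀ p q, star (A q p) =
      (![1, 1, -1, -1] : Fin 4 → ℂ) (quarkEquiv.symm p).2.2.2 * A p q *
        (![1, 1, -1, -1] : Fin 4 → ℂ) (quarkEquiv.symm q).2.2.2) :
    kMatrix A = A := by
  ext p q
  change ∑ α : Fin 4, ∑ β : Fin 4, gammaFive (quarkEquiv.symm p).2.2.2 β *
      star (A (kSpinIdx q α) (kSpinIdx p β)) * gammaFive α (quarkEquiv.symm q).2.2.2 = A p q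
  rw [Fintype.sum_eq_single (quarkEquiv.symm q).2.2.2 ?_,
    Fintype.sum_eq_single (quarkEquiv.symm p).2.2.2 ?_]
  · -- the surviving term: `ε_p (ε_p A_{pq} ε_q) ε_q = A_{pq}`
    rw [kSpinIdx_self, kSpinIdx_self, hA p q, gammaFive_eq_diagonal, Matrix.diagonal_apply_eq,
      Matrix.diagonal_apply_eq]
    have hp := gammaFiveSign_mul_self (quarkEquiv.symm p).2.2.2
    have hq := gammaFiveSign_mul_self (quarkEquiv.symm q).2.2.2
    calc (![1, 1, -1, -1] : Fin 4 → ℂ) (quarkEquiv.symm p).2.2.2 *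
          ((![1, 1, -1, -1] : Fin 4 → ℂ) (quarkEquiv.symm p).2.2.2 * A p q *
            (![1, 1, -1, -1] : Fin 4 → ℂ) (quarkEquiv.symm q).2.2.2) *
          (![1, 1, -1, -1] : Fin 4 → ℂ) (quarkEquiv.symm q).2.2.2
        = (![1, 1, -1, -1] : Fin 4 → ℂ) (quarkEquiv.symm p).2.2.2 *
            (![1, 1, -1, -1] : Fin 4 → ℂ) (quarkEquiv.symm p).2.2.2 * A p q *
            ((![1, 1, -1, -1] : Fin 4 → ℂ) (quarkEquiv.symm q).2.2.2 *
              (![1, 1, -1, -1] : Fin 4 → ℂ) (quarkEquiv.symm q).2.2.2) := by ring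
      _ = A p q := by rw [hp, hq, one_mul, mul_one]
  · -- `β ≠ σ_p`: the factor `(γ₅)_{σ_p β}` vanishes
    intro β hβ
    rw [gammaFive_eq_diagonal, Matrix.diagonal_apply_ne _ (Ne.symm hβ), zero_mul, zero_mul]
  · -- `α ≠ σ_q`: the factor `(γ₅)_{α σ_q}` vanishes
    intro α hα
    rw [gammaFive_eq_diagonal, Matrix.diagonal_apply_ne _ hα]
    simp only [mul_zero, Finset.sum_const_zero]

/-- **`(D^{AP}(U))^K = D^{AP}(U)`**: the `K`-conjugate `γ₅ (D^{AP})† γ₅` (blockwise) of the antiperiodic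
`N_f`-flavour Wilson–Dirac matrix is the matrix itself — `γ₅`-hermiticity of the antiperiodic
operator (the boundary signs are real). [cite: MontvayMunster1994, §5.1.2 (5.15) and §4.2.4 (4.114)] -/
theorem kMatrix_diracMatrixAP (U : GaugeConfig 4 L (Matrix.specialUnitaryGroup (Fin 3) ℂ))
    (mq : Fin Nf → ℝ) : kMatrix (diracMatrixAP U mq) = diracMatrixAP U mq :=
  kMatrix_eq_self_of_signConj _ (star_diracMatrixAP_apply U mq)

/-! ### `K` fixes the antiperiodic Boltzmann factor and conjugates the antiperiodic functional -/

/-- **`K e^{−ψ̄D^{AP}(U)ψ} = e^{−ψ̄D^{AP}(U)ψ}`**: the Literature `γ₅`-conjugation fixes the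
time-antiperiodic Wilson quark Boltzmann factor (`K exp = exp K`, `K(ψ̄Aψ) = ψ̄A^Kψ`,
`(−D^{AP})^K = −(D^{AP})^K = −D^{AP}`). [cite: MontvayMunster1994, §5.1.2 (5.15) and §4.1.3 (4.34)] -/
theorem torusK_fermiBoltzmannAP (U : GaugeConfig 4 L (Matrix.specialUnitaryGroup (Fin 3) ℂ))
    (mq : Fin Nf → ℝ) : torusK (fermiBoltzmannAP U mq) = fermiBoltzmannAP U mq := by
  rw [fermiBoltzmannAP, torusK_grassmannExp (isNilpotent_quadratic ℂ _), torusK_quadratic,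
    kMatrix_neg, kMatrix_diracMatrixAP]

/-- **`⟨K ∘ X⟩^{AP} = conj ⟨X⟩^{AP}` for the Literature `γ₅`-conjugation**: numerator
`∫dμ_W ∫dψ̄dψ K(X)e^{−S_AP} = ∫dμ_W ∫dψ̄dψ K(X e^{−S_AP}) = det K₀ · conj N` and denominator
`D = det K₀ · conj D`, so the ratio is conjugated (junk `0/0` on both sides otherwise). [cite: MontvayMunster1994, §5.1.2 (5.15)–(5.16)] -/
theorem qcdTorusExpectAP_torusK (β : ℝ) (mq : Fin Nf → ℝ)
    (X : GaugeConfig 4 L (Matrix.specialUnitaryGroup (Fin 3) ℂ) → FermiAlg Nf L) :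
    qcdTorusExpectAP β L mq (fun U => torusK (X U)) =
      starRingEnd ℂ (qcdTorusExpectAP β L mq X) := by
  unfold qcdTorusExpectAP
  refine div_eq_conj_div_of_eq_mul_conj (c := kBerezinConst Nf L) ?_ ?_
  · refine (integral_congr_ae (Filter.Eventually.of_forall fun U => ?_)).trans
      (integral_fermiIntegral_torusK _ fun U => X U * fermiBoltzmannAP U mq)
    simp only [torusK_mul, torusK_fermiBoltzmannAP]
  · refine (integral_congr_ae (Filter.Eventually.of_forall fun U => ?_)).trans
      (integral_fermiIntegral_torusK _ fun U => fermiBoltzmannAP U mq)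
    simp only [torusK_fermiBoltzmannAP]

/-! ### The registered stub -/

/-- **Stub K1' of the birth skeleton of `TorusHalfSpectrum` (= `ConjugationExpectAPStmt` unfolded):
`γ₅`-conjugation symmetry of the time-antiperiodic torus functional.**  Any `γ₅`-conjugation `K`
agrees with `torusK` (`eq_torusK_of_clauses`, uniqueness from the six clauses by
`ExteriorAlgebra.induction`); `torusK` fixes the antiperiodic Wilson quark Boltzmann factor
(`torusK_fermiBoltzmannAP`: `γ₅`-hermiticity of `diracMatrixAP`, `wilsonDiracAP_signConj_apply`, through
`kMatrix_diracMatrixAP`) and conjugates the antiperiodic functional (`qcdTorusExpectAP_torusK`: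
`∫dψ̄dψ ∘ K = det K₀ · conj ∘ ∫dψ̄dψ`, `∫ conj = conj ∫`, the constant cancels in the ratio). -/
theorem stub_gammaFiveConj_expectAP :
    ∀ (Nf S : ℕ) [NeZero S] (K : FermiAlg Nf S → FermiAlg Nf S),
      ((∀ x y, K (x * y) = K x * K y) ∧ (∀ x y, K (x + y) = K x + K y) ∧
        (∀ (c : ℂ) (x : FermiAlg Nf S), K (c • x) = starRingEnd ℂ c • K x) ∧ K 1 = 1 ∧
        (∀ v : QuarkVar Nf S, K (_root_.Literature.MathematicalPhysics.QuantumFieldTheory.q v) =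
          -∑ σ : Fin 4, _root_.Literature.MathematicalPhysics.QuantumLattice.gammaFive σ v.2.2.2 •
            _root_.Literature.MathematicalPhysics.QuantumFieldTheory.qbar (v.1, (v.2.1, v.2.2.1, σ))) ∧
        (∀ v : QuarkVar Nf S, K (_root_.Literature.MathematicalPhysics.QuantumFieldTheory.qbar v) =
          ∑ σ : Fin 4, _root_.Literature.MathematicalPhysics.QuantumLattice.gammaFive v.2.2.2 σ •
            _root_.Literature.MathematicalPhysics.QuantumFieldTheory.q (v.1, (v.2.1, v.2.2.1, σ)))) →
      (∀ (U : GaugeConfig 4 S (Matrix.specialUnitaryGroup (Fin 3) ℂ)) (mq : Fin Nf → ℝ),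
          K (fermiBoltzmannAP U mq) = fermiBoltzmannAP U mq) ∧
        ∀ (β : ℝ) (mq : Fin Nf → ℝ)
          (X : GaugeConfig 4 S (Matrix.specialUnitaryGroup (Fin 3) ℂ) → FermiAlg Nf S),
          qcdTorusExpectAP β S mq (fun U => K (X U)) = starRingEnd ℂ (qcdTorusExpectAP β S mq X) := by
  intro Nf S _ K hK
  obtain ⟨hmul, hadd, hsmul, hone, hq, hqbar⟩ := hK
  have hKt : ∀ a, K a = torusK a := eq_torusK_of_clauses hmul hadd hsmul hone hq hqbar
  refine ⟨fun U mq => ?_, fun β mq X => ?_⟩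
  · rw [hKt, torusK_fermiBoltzmannAP]
  · have hX : (fun U => K (X U)) = fun U => torusK (X U) := funext fun U => hKt (X U)
    rw [hX, qcdTorusExpectAP_torusK]

end Summit.QuantumFields.QCD.Cruxes.TorusHalfSpectrum.Birth.GammaFiveConjExpectAP

end
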